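import Summits.PneNP.PneNP.Theorems.SmallBlockRothvossBallGridBound
import HarnessLib

/-!
# Block psd lifts of the perfect matching polytope: mixed block sizes (cell pnp-psdrank, rung F-N2.SOC)

Landing file 5 (pnp-psdrank-eng g4; work file HOME/pnp-psdrank-eng/lean/BlockLift.lean v4). Zero-padding
(`X ↦ E X Eᴴ`, `E` = the first `k` columns of the identity, no new definitions) turns a psd factorization of the odd-cut slack
matrix of `P_PM(n)` through `S^{β_1}_+ × ⋯ × S^{β_m}_+` with all `β_i ≤ b` into an `(S^b_+)^m` factorization
(`hasBlockPsdFactorization_of_mixed`), so the block bound applies to SDP lifts with blocks of dimension AT MOST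
`b`: `blockPsd_largeBlocks_mixed` — `2^{c·n/(b+1)} ≤ m·n⁹` for `1 ≤ b ≤ n`. [cite: Rothvoss2017, Thm. 1]
[cite: GouveiaParriloThomas2013, Def. 2.2, Thm. 2.4 (cone lifts = cone factorizations)]
WHAT THIS IS NOT: not a bound on general psd rank / SDP extension complexity of matching (rung F-N2 stays open);
nothing P ≠ NP-relevant.
-/

set_option linter.dupNamespace false -- `Summit.PneNP.PneNP.…`: summit = sub-problem (D-0017)

noncomputable section

open scoped Classical MatrixOrder

open Finset Real Matrix Literature.Barriers.PneNP Literature.Combinatorics.Optimization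

namespace Summit.PneNP.PneNP.Theorems.SmallBlockRothvossBallGrid

/-! ### Mixed block sizes: zero-padding to the largest block -/

section Pad

variable {k b : ℕ} (hk : k ≤ b)

/-- The first `k` columns `E = (1 : 𝕊^b).submatrix id (castLE)` of the `b × b` identity satisfy `Eᴴ E = 1`. -/
theorem castLE_cols_conjTranspose_mul :
    ((1 : Matrix (Fin b) (Fin b) ℝ).submatrix id (Fin.castLE hk))ᴴ *
      (1 : Matrix (Fin b) (Fin b) ℝ).submatrix id (Fin.castLE hk) = 1 := by
  ext j j'
  rw [Matrix.mul_apply]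
  simp only [conjTranspose_apply, submatrix_apply, id, star_trivial, Matrix.one_apply]
  have hinj : Function.Injective (Fin.castLE hk) := Fin.castLE_injective hk
  by_cases hjj : j = j'
  · subst hjj
    rw [if_pos rfl]
    rw [Finset.sum_eq_single (Fin.castLE hk j)]
    · simp
    · intro p _ hp
      rw [if_neg hp]; simp
    · intro h; exact absurd (Finset.mem_univ _) h
  · rw [if_neg hjj]
    refine Finset.sum_eq_zero fun p _ => ?_
    by_cases h1 : p = Fin.castLE hk j
    · subst h1
      have h2 : Fin.castLE hk j ≠ Fin.castLE hk j' := fun h => hjj (hinj h)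
      rw [if_neg h2]; simp
    · rw [if_neg h1]; simp

/-- Zero-padding `X ↦ E X Eᴴ` of a `k × k` block to a `b × b` block preserves positive semidefiniteness. -/
theorem posSemidef_pad {X : Matrix (Fin k) (Fin k) ℝ} (hX : X.PosSemidef) :
    ((1 : Matrix (Fin b) (Fin b) ℝ).submatrix id (Fin.castLE hk) * X *
      ((1 : Matrix (Fin b) (Fin b) ℝ).submatrix id (Fin.castLE hk))ᴴ).PosSemidef :=
  hX.mul_mul_conjTranspose_same _

/-- Zero-padding preserves pairings: `tr(E X Eᴴ · E Y Eᴴ) = tr(X Y)`. -/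
theorem trace_pad_mul_pad (X Y : Matrix (Fin k) (Fin k) ℝ) :
    ((1 : Matrix (Fin b) (Fin b) ℝ).submatrix id (Fin.castLE hk) * X *
        ((1 : Matrix (Fin b) (Fin b) ℝ).submatrix id (Fin.castLE hk))ᴴ *
      ((1 : Matrix (Fin b) (Fin b) ℝ).submatrix id (Fin.castLE hk) * Y *
        ((1 : Matrix (Fin b) (Fin b) ℝ).submatrix id (Fin.castLE hk))ᴴ)).trace = (X * Y).trace := by
  set E : Matrix (Fin b) (Fin k) ℝ := (1 : Matrix (Fin b) (Fin b) ℝ).submatrix id (Fin.castLE hk) with hE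
  have hEE : Eᴴ * E = 1 := castLE_cols_conjTranspose_mul hk
  have h1 : E * X * Eᴴ * (E * Y * Eᴴ) = E * (X * Y) * Eᴴ := by
    calc E * X * Eᴴ * (E * Y * Eᴴ) = E * X * (Eᴴ * E) * Y * Eᴴ := by simp only [Matrix.mul_assoc]
      _ = E * (X * Y) * Eᴴ := by rw [hEE, Matrix.mul_one]; simp only [Matrix.mul_assoc]
  rw [h1, Matrix.trace_mul_cycle, hEE, Matrix.one_mul]

end Pad

/-- **Mixed block sizes reduce to the largest block**: a psd factorization of the odd-cut slack matrix of
`P_PM(n)` through `S^{β_1}_+ × ⋯ × S^{β_m}_+` with all `β_i ≤ b` is an `(S^b_+)^m` factorization (pad every block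
with zeros). So all statements about `HasBlockPsdFactorization n b m` apply to SDP lifts whose blocks have
dimension at most `b`. -/
theorem hasBlockPsdFactorization_of_mixed {n b m : ℕ} (β : Fin m → ℕ) (hβ : ∀ i, β i ≤ b)
    (A : Finset (Sym2 (Fin n)) → (i : Fin m) → Matrix (Fin (β i)) (Fin (β i)) ℝ)
    (B : Finset (Fin n) → (i : Fin m) → Matrix (Fin (β i)) (Fin (β i)) ℝ)
    (hA : ∀ M i, IsPMOn (univ : Finset (Fin n)) M → (A M i).PosSemidef)
    (hB : ∀ U i, Odd U.card → (B U i).PosSemidef)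
    (hS : ∀ U M, Odd U.card → IsPMOn (univ : Finset (Fin n)) M →
      pmSlack U M = ∑ i, (A M i * B U i).trace) :
    HasBlockPsdFactorization n b m := by
  refine ⟨fun M i => (1 : Matrix (Fin b) (Fin b) ℝ).submatrix id (Fin.castLE (hβ i)) * A M i *
      ((1 : Matrix (Fin b) (Fin b) ℝ).submatrix id (Fin.castLE (hβ i)))ᴴ,
    fun U i => (1 : Matrix (Fin b) (Fin b) ℝ).submatrix id (Fin.castLE (hβ i)) * B U i *
      ((1 : Matrix (Fin b) (Fin b) ℝ).submatrix id (Fin.castLE (hβ i)))ᴴ,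
    fun M i hM => posSemidef_pad (hβ i) (hA M i hM), fun U i hU => posSemidef_pad (hβ i) (hB U i hU),
    fun U M hU hM => ?_⟩
  rw [hS U M hU hM]
  exact sum_congr rfl fun i _ => (trace_pad_mul_pad (hβ i) (A M i) (B U i)).symm

/-- **Large blocks, mixed sizes.** `blockPsd_largeBlocks` for SDP lifts with blocks of dimensions
`β_1, …, β_m ≤ b ≤ n`: `2^{c·n/(b+1)} ≤ m·n⁹`. -/
theorem blockPsd_largeBlocks_mixed : ∃ c : ℝ, 0 < c ∧ ∃ n₀ : ℕ, ∀ n : ℕ, n₀ ≤ n → Even n →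
    ∀ b m : ℕ, 1 ≤ b → b ≤ n → ∀ (β : Fin m → ℕ), (∀ i, β i ≤ b) →
    ∀ (A : Finset (Sym2 (Fin n)) → (i : Fin m) → Matrix (Fin (β i)) (Fin (β i)) ℝ)
      (B : Finset (Fin n) → (i : Fin m) → Matrix (Fin (β i)) (Fin (β i)) ℝ),
      (∀ M i, IsPMOn (univ : Finset (Fin n)) M → (A M i).PosSemidef) →
      (∀ U i, Odd U.card → (B U i).PosSemidef) →
      (∀ U M, Odd U.card → IsPMOn (univ : Finset (Fin n)) M → pmSlack U M = ∑ i, (A M i * B U i).trace) →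
      (2 : ℝ) ^ (c * n / (b + 1)) ≤ m * (n : ℝ) ^ 9 := by
  obtain ⟨c, hc, n₀, hn₀⟩ := blockPsd_largeBlocks
  exact ⟨c, hc, n₀, fun n hn heven b m hb hbn β hβ A B hA hB hS =>
    hn₀ n hn heven b m hb hbn (hasBlockPsdFactorization_of_mixed β hβ A B hA hB hS)⟩

end Summit.PneNP.PneNP.Theorems.SmallBlockRothvossBallGrid

end
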